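import Summits.HodgeConjecture.HodgeConjecture.Theorems.F0P3cStCharTSKeys3AnnulusVanishing         -- ★ (this seat) analytic half; brings ★ TorusConjBall, ★ B3, ★ SHELL, ★ DICT, ★ B4
import Summits.HodgeConjecture.HodgeConjecture.Theorems.F0P3cStCharTSKeys3SplitTestDatum          -- ★ (F0P2-p01) D1 «JACQUET SPLIT TEST @ CM DATUM»: `pair_normalizedJacquet_mk_eq_smul_of_forall_integral_eq_zero`
import Summits.HodgeConjecture.HodgeConjecture.Theorems.F0P3cStCharTSKeys3JacquetSemisimple        -- ★ (this seat) B6a: `secondEigenfunctional_of_one_vector`; brings ★ N1 `F0P3U3PrincipalSeriesOpenCellTorusChar`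
import Summits.HodgeConjecture.HodgeConjecture.Theorems.F0P3cStCharTSKeys3AnnulusDock            -- ★ (F0P2-p01) D2A «ANNULUS DOCK»: `integral_cellFun_sub_eq_smul_sub_setIntegral_normBall` (★ B5 on norm balls)
import Summits.HodgeConjecture.HodgeConjecture.Theorems.F0P3cStCharTSKeysRedThreeOfEigenfunctional -- ★ FILE 2: `keysRedThree_of_secondEigenfunctional`
import Summits.HodgeConjecture.HodgeConjecture.Theorems.F0P3cStCharTSWeylFixedIffNormTrivial       -- ★ `cmWeylTorusCharPair_eq_of_apply_fixed_eq_one` (`wχ = χ`)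
import HarnessLib

/-!
# F0 · P3c · «StCharTS» — ROAD «KEYS3-ANALYTIC», CLOSING FILE «KEYS (3) ANALYTIC HALF★»: the `hSecond` binder of ★ `keysRedThree_of_secondEigenfunctional` PROVED at every
# non-split `v`, hence RUNG 0's named input `hKeysRed3` (Keys' reducibility of `i_G(χ₁, χ₂)` for `χ₁|_{F_v^×} = 1`, `χ₁ ≠ 1`) [Keys1984 §7 Thm. (1); Rogawski1990 §12.2 (3)]

Cell `pub/hodgecm-mathlib`, crux H413 = `stmt-HodgeConjecture-24833` (lane `--supports … --as helper`), route HCCMUnconditional; seat F0P2-p06 (g21), ROAD holder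
(LEAD F0P3a-plan T15-03; MEMO `F0/P2/F0P2-p06/g21/MEMO-KEYS3-analytic-road.v3`).  THEOREMS ONLY (0 def ∕ 0 instance ∕ 0 notation ∕ 0 sorry); ★-only imports.

The argument (uniform in the ramification of `E_w/F_v` and in `|2|`): by ★ D1 (split test) `r_B(m)[f₀] = χ(m)[f₀]` iff the Haar functional of the cell function of the test vector
`g₀(m) = δ_B^{-1/2}(m)·(m·f₀) − χ(m)·f₀` vanishes; by ★ B5 (annulus formula, with ★ T2's Jacobian, ★ T3b's `χ(ʷm) = wχ(m)`, ★ `weylScalar_eq` and `wχ = χ`) that functional is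
`χ(m) • (∫_{K_{A/‖d₀‖²}} F − ∫_{K_A} F)` (`F(u) = f₀(w₀ u)`, `K_A = {‖u₀₂‖ ≤ A}` ⊇ the support of the cell function of `g₀(m)`, `m⁻¹ K_A m = K_{A/‖d₀‖²}` ★ `image_torusConj_normBall`);
by ★ «ANNULUS VANISHING AT THE CM PLACE» the bracket is `0` for `A` large (★ B4 far out + ★ B3 docked by ★ SHELL: a non-trivial character of `E¹ ≅ E^×/F^×` integrates to `0` over a
fundamental domain).  So `r_B(m)[f₀] = χ(m)[f₀]` for ALL `m`, and ★ B6a (`secondEigenfunctional_of_one_vector`) yields the second eigenfunctional.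
* §1 `integral_cellFun_testVector_eq_zero` — at the CM datum, for `μ = heisHaar`: `∫_N g₀(m)(w₀ u) dμ = 0` for every `m ∈ T` and every section `f` (★ D2A + ★ «ANNULUS VANISHING»).
* §2 **`hSecond_holds`** (the `hSecond` binder text of ★ FILE 2 VERBATIM, proved) and **`hKeysRed3_holds`** (RUNG 0's `hKeysRed3` text at a non-split `v`, proved).
HONEST LABEL: HC_CM is proved only modulo the 7 printed citations (2 remaining named inputs: hLiu418 = `stmt-HodgeConjecture-24832`, h413 = `stmt-HodgeConjecture-24833`) until rung 0
closes; this file discharges the analytic half of Keys' case (3) inside `hKeysRed3`; count-neutral until the rung-0 edition consumes it.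

## References
* [Keys1984] D. Keys, *Principal series representations of special unitary groups over local fields*, Compositio Math. 51 (1984), §3; §7 Thm. (1) p. 126.
* [Rogawski1990] J. Rogawski, *Automorphic representations of unitary groups in three variables*, Annals of Math. Studies 123 (1990), §12.1 p. 171; §12.2 (3) pp. 173–174.
* [Casselman1995] W. Casselman, *Introduction to the theory of admissible representations of p-adic reductive groups* (1995), §6.3, Lemma 7.1.1 (a).
* [BernsteinZelevinsky1977] I. N. Bernstein, A. V. Zelevinsky, Ann. Sci. ÉNS 10 (1977), Prop. 1.9 (a), §2.3, §5 (5.2).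
-/

set_option autoImplicit false
set_option linter.dupNamespace false

noncomputable section

open NumberField IsDedekindDomain MeasureTheory Set
open scoped Matrix NNReal ENNReal
open Literature.NumberTheory.Automorphic Literature.NumberTheory.Automorphic.UnitaryGroup Literature.NumberTheory.Automorphic.UnitaryGroup.HeisRing
open Literature.NumberTheory.GaloisRepresentations Literature.NumberTheory.GaloisRepresentations.IsNonarchimedeanLocalField
open Summit.HodgeConjecture.HodgeConjecture.Cruxes.H413
open Summit.HodgeConjecture.HodgeConjecture.Cruxes.H413.F0P3cStCharTSLocalRingNormDictionary
open Summit.HodgeConjecture.HodgeConjecture.Cruxes.H413.F0P3cStCharTSLocalRingNormCompactness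
open Summit.HodgeConjecture.HodgeConjecture.Cruxes.H413.F0P3cStCharTSKeys3TorusConjBall
open Summit.HodgeConjecture.HodgeConjecture.Cruxes.H413.F0P3U3PrincipalSeriesOpenCellTorusChar

namespace Summit.HodgeConjecture.HodgeConjecture.Cruxes.H413.F0P3cStCharTSKeys3AnalyticHalf

/-! ## §1 At the CM datum: the Haar functional of the cell function of every test vector vanishes -/

section CM

variable (L : Type) [Field L] [NumberField L] [IsCMField L] (v : HeightOneSpectrum (𝓞 ↥(maximalRealSubfield L)))
  (hns : ∀ w : PlacesOver L v, IsCMField.complexConj L • w.1 = w.1)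

include hns in
set_option synthInstance.maxHeartbeats 400000 in
set_option maxHeartbeats 6400000 in
-- statement∕proof-heavy: the `SmoothInd` carrier of ★ `cmPrincipalSeries` and the scalar data `hs`/`hμ` of ★ B5 (class of ★ N1 `normalizedJacquet_eq_weylChar_smul_of_witnesses`)
/-- **`∫_N g₀(m)(w₀ u) dμ(u) = 0`** at a non-split `v` for `μ = heisHaar` (the coordinate Haar measure of `N(L⁺_v)`), EVERY `m ∈ T(L⁺_v)` and EVERY section `f` of `i_G(χ₁, χ₂)`
(`χ₁|_{F_v^×} = 1`, `χ₁ ≠ 1`): ★ D2A «ANNULUS FORMULA ON NORM BALLS» (`∫ = χ(m) • (∫_{K_{A/‖d₀‖²}} F − ∫_{K_A} F)` for `K_A ⊇ tsupport`, ★ B5 + ★ T2 + ★ T3b + ★ `weylScalar_eq`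
+ `wχ = χ`) and ★ «ANNULUS VANISHING AT THE CM PLACE» (the bracket is `0` for `A` large), at `A = max A₁ A₂`.
[cite: Keys1984, §7 Thm. (1) p. 126] [cite: Rogawski1990, §12.2 (3) p. 174] [cite: Casselman1995, §6.3, Lemma 7.1.1 (a)] [cite: BernsteinZelevinsky1977, §5 (5.2)] -/
theorem integral_cellFun_testVector_eq_zero [MeasurableSpace (LocalRing L v)] [BorelSpace (LocalRing L v)] [Invertible (2 : LocalRing L v)]
    (χ₁ : (LocalRing L v)ˣ →* ℂˣ) (χ₂ : ↥(normOneUnits (conjLocal L (IsCMField.complexConj L) v)) →* ℂˣ)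
    (h₁ : Continuous fun x => ((χ₁ x : ℂˣ) : ℂ))
    (htriv : ∀ a : (LocalRing L v)ˣ, (conjLocal L (IsCMField.complexConj L) v) (a : LocalRing L v) = a → χ₁ a = 1) (hne : χ₁ ≠ 1)
    (w₀ : ↥(unitaryGroupOfForm (conjLocal L (IsCMField.complexConj L) v) (cmLocalForm L 3 v)))
    (hw₀ : Units.val (w₀ : GL (Fin 3) (LocalRing L v)) = cmLocalForm L 3 v)
    (μX : Measure (LocalRing L v)) [μX.IsAddHaarMeasure]
    (μY : Measure ↥(skewPart (conjLocal L (IsCMField.complexConj L) v))) [μY.IsAddHaarMeasure] [μY.Regular]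
    [MeasurableSpace ↥(cmBorelTriple L 3 v).N] [BorelSpace ↥(cmBorelTriple L 3 v).N]
    (m : ↥(cmBorelTriple L 3 v).M)
    (f : haveI := locallyCompactSpace_cmBorelU L 3 v
      Representation.SmoothInd (cmBorelTriple L 3 v).P
        (Representation.twist
          (((Representation.trivial ℂ ↥(torusU (conjLocal L (IsCMField.complexConj L) v) (cmLocalForm L 3 v)) ℂ).twist
            (cmTorusCharPair L v χ₁ χ₂)).comp (cmBorelTriple L 3 v).proj) (rootDeltaChar (cmBorelTriple L 3 v).P))) :
    haveI := locallyCompactSpace_cmBorelU L 3 v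
    ∫ n : ↥(cmBorelTriple L 3 v).N,
        ((((rootDeltaChar (cmBorelTriple L 3 v).P (Subgroup.inclusion (cmBorelTriple L 3 v).M_le m))⁻¹ : ℂˣ) : ℂ) •
              cmPrincipalSeries L 3 v (cmTorusCharPair L v χ₁ χ₂)
                (m : ↥(unitaryGroupOfForm (conjLocal L (IsCMField.complexConj L) v) (cmLocalForm L 3 v))) f -
            ((cmTorusCharPair L v χ₁ χ₂ m : ℂˣ) : ℂ) • f).toFun
          ((w₀ : ↥(unitaryGroupOfForm (conjLocal L (IsCMField.complexConj L) v) (cmLocalForm L 3 v))) * n)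
        ∂(heisHaar (conjLocal L (IsCMField.complexConj L) v) (conjLocal_conjLocal_cm L v) (continuous_conjLocal L (IsCMField.complexConj L) v)
            (cmLocalForm_eq_over L 3 v) μX μY) = 0 := by
  haveI := locallyCompactSpace_cmBorelU L 3 v
  haveI : SecondCountableTopology (LocalRing L v) := secondCountableTopology_localRing (E := L) v
  haveI := isHaarMeasure_heisHaar (conjLocal L (IsCMField.complexConj L) v) (conjLocal_conjLocal_cm L v) (continuous_conjLocal L (IsCMField.complexConj L) v)
    (cmLocalForm_eq_over L 3 v) μX μY
  -- `wχ = χ` (Keys' case (3): `χ₁|_{F_v^×} = 1`); `m = diag(d)`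
  have hw' := F0P3cStCharTSWeylFixedIffNormTrivial.cmWeylTorusCharPair_eq_of_apply_fixed_eq_one L v χ₁ χ₂ htriv
  obtain ⟨d, hd⟩ := m.2
  -- the support ball `K_{A₂}` (★ D2A) and the far-out threshold `A₁` (★ «ANNULUS VANISHING»)
  obtain ⟨A₂, hA₂⟩ := F0P3cStCharTSKeys3AnnulusDock.exists_subset_normBall_of_isCompact L v
    (F0P3cStCharTSKeys3AnnulusDock.hasCompactSupport_cellFun_cellTestVector L v hns w₀ hw₀ (cmTorusCharPair L v χ₁ χ₂) m f).isCompact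
  obtain ⟨A₁, hA₁⟩ := F0P3cStCharTSKeys3AnnulusVanishing.exists_forall_setIntegral_normBall_sub_eq_zero L v hns χ₁ χ₂ h₁ htriv hne w₀ hw₀ μX μY (d 0) f
  rw [F0P3cStCharTSKeys3AnnulusDock.integral_cellFun_sub_eq_smul_sub_setIntegral_normBall L v hns χ₁ χ₂ w₀ hw₀
      (heisHaar (conjLocal L (IsCMField.complexConj L) v) (conjLocal_conjLocal_cm L v) (continuous_conjLocal L (IsCMField.complexConj L) v)
        (cmLocalForm_eq_over L 3 v) μX μY) hw' m hd f (hA₂ (max A₁ A₂) (le_max_right _ _)),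
    hA₁ (max A₁ A₂) (le_max_left _ _), smul_zero]

/-! ## §2 The second eigenfunctional and Keys' reducibility at a non-split place -/

include hns in
set_option synthInstance.maxHeartbeats 400000 in
set_option maxHeartbeats 6400000 in
-- statement-heavy: the `hSecond` binder text of ★ `keysRedThree_of_secondEigenfunctional` (class of ★ FILE 2)
/-- **«KEYS (3) ANALYTIC HALF★» — the `hSecond` binder of ★ `F0P3cStCharTSKeysRedThreeOfEigenfunctional.keysRedThree_of_secondEigenfunctional` PROVED at a non-split `v`:**
for continuous `χ₁, χ₂` with `χ₁|_{F_v^×} = 1`, `χ₁ ≠ 1`, `i_G(χ₁, χ₂)` carries a `(B, χ δ_B^{1/2})`-eigenfunctional not proportional to evaluation at `1`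
(★ B6a on the standard section `f₀`, `r_B(m)[f₀] = χ(m)[f₀]` for all `m` by ★ D1 and §2 with `μ = heisHaar`). [cite: Keys1984, §3; §7 Thm. (1) p. 126] [cite: Rogawski1990, §12.2 (3) pp. 173–174]
[cite: Casselman1995, Lemma 7.1.1 (a)] -/
theorem hSecond_holds :
    haveI := locallyCompactSpace_cmBorelU L 3 v
    ∀ (χ₁ : (UnitaryGroup.LocalRing L v)ˣ →* ℂˣ) (χ₂ : ↥(normOneUnits (conjLocal L (IsCMField.complexConj L) v)) →* ℂˣ),
      Continuous (fun x => ((χ₁ x : ℂˣ) : ℂ)) → Continuous (fun x => ((χ₂ x : ℂˣ) : ℂ)) →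
      (∀ a : (UnitaryGroup.LocalRing L v)ˣ, (conjLocal L (IsCMField.complexConj L) v) (a : UnitaryGroup.LocalRing L v) = a → χ₁ a = 1) → χ₁ ≠ 1 →
      ∃ ℓ : Representation.SmoothInd (cmBorelTriple L 3 v).P
          (Representation.twist (((Representation.trivial ℂ ↥(torusU (conjLocal L (IsCMField.complexConj L) v) (cmLocalForm L 3 v)) ℂ).twist
            (UnitaryGroup.cmTorusCharPair L v χ₁ χ₂)).comp (cmBorelTriple L 3 v).proj) (rootDeltaChar (cmBorelTriple L 3 v).P)) →ₗ[ℂ] ℂ,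
        (∀ (p : ↥(cmBorelTriple L 3 v).P) (f : _),
          ℓ (UnitaryGroup.cmPrincipalSeries L 3 v (UnitaryGroup.cmTorusCharPair L v χ₁ χ₂) p.1 f) =
            ((UnitaryGroup.cmTorusCharPair L v χ₁ χ₂ ((cmBorelTriple L 3 v).proj p) : ℂˣ) : ℂ) *
              ((rootDeltaChar (cmBorelTriple L 3 v).P p : ℂˣ) : ℂ) * ℓ f) ∧
        ∀ c : ℂ, ∃ f, ℓ f ≠ c * f.toFun 1 := by
  haveI := locallyCompactSpace_cmBorelU L 3 v
  intro χ₁ χ₂ h₁ h₂ htriv hne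
  haveI : LocallyCompactSpace ↥(unitaryGroupOfForm (conjLocal L (IsCMField.complexConj L) v) (cmLocalForm L 3 v)) := locallyCompactSpace_local (IsCMField.complexConj L) 3 _ v
  haveI : SecondCountableTopology (LocalRing L v) := secondCountableTopology_localRing (E := L) v
  letI : MeasurableSpace (LocalRing L v) := borel _
  haveI : BorelSpace (LocalRing L v) := ⟨rfl⟩
  letI : Invertible (2 : LocalRing L v) := (isUnit_two_localRing L v).invertible
  letI : MeasurableSpace ↥(cmBorelTriple L 3 v).N := borel _
  haveI : BorelSpace ↥(cmBorelTriple L 3 v).N := ⟨rfl⟩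
  haveI := locallyCompactSpace_skewPart (conjLocal L (IsCMField.complexConj L) v) (continuous_conjLocal L (IsCMField.complexConj L) v)
  haveI := isHaarMeasure_heisHaar (conjLocal L (IsCMField.complexConj L) v) (conjLocal_conjLocal_cm L v) (continuous_conjLocal L (IsCMField.complexConj L) v)
    (cmLocalForm_eq_over L 3 v) (Measure.addHaar : Measure (LocalRing L v)) (Measure.addHaar : Measure ↥(skewPart (conjLocal L (IsCMField.complexConj L) v)))
  obtain ⟨w₀, hw₀⟩ := exists_weylElt_three L v hns
  obtain ⟨f₀, hf₀, -⟩ := (exists_cmPrincipalSeries_cmTorusCharPair_toFun_one_eq_one L v χ₁ χ₂ h₁ h₂).1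
  exact F0P3cStCharTSKeys3JacquetSemisimple.secondEigenfunctional_of_one_vector L v hns χ₁ χ₂ h₁ h₂
    (F0P3cStCharTSWeylFixedIffNormTrivial.cmWeylTorusCharPair_eq_of_apply_fixed_eq_one L v χ₁ χ₂ htriv) f₀ hf₀
    (F0P3cStCharTSKeys3SplitTestDatum.pair_normalizedJacquet_mk_eq_smul_of_forall_integral_eq_zero L v hns χ₁ χ₂ h₁ h₂ w₀ hw₀
      (heisHaar (conjLocal L (IsCMField.complexConj L) v) (conjLocal_conjLocal_cm L v) (continuous_conjLocal L (IsCMField.complexConj L) v)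
        (cmLocalForm_eq_over L 3 v) Measure.addHaar Measure.addHaar) f₀
      fun m => integral_cellFun_testVector_eq_zero L v hns χ₁ χ₂ h₁ htriv hne w₀ hw₀ Measure.addHaar Measure.addHaar m f₀)

include hns in
set_option synthInstance.maxHeartbeats 400000 in
set_option maxHeartbeats 6400000 in
-- statement-heavy: two ∀-closed binder texts over the `SmoothInd` carrier (class of ★ FILE 2)
/-- **RUNG 0's named input `hKeysRed3` at a non-split `v`, PROVED**: for continuous `χ₁, χ₂` with `χ₁|_{F_v^×} = 1` and `χ₁ ≠ 1`, the principal series `i_G(χ₁, χ₂)` of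
`U(3)(L⁺_v)` has a proper non-zero invariant subspace (Keys' case (3); Rogawski §12.2 (3)) — ★ `keysRedThree_of_secondEigenfunctional` applied to `hSecond_holds`.
[cite: Keys1984, §7 Thm. (1) p. 126] [cite: Rogawski1990, §12.2 (3) pp. 173–174] -/
theorem hKeysRed3_holds :
    haveI := locallyCompactSpace_cmBorelU L 3 v
    ∀ (χ₁ : (UnitaryGroup.LocalRing L v)ˣ →* ℂˣ) (χ₂ : ↥(normOneUnits (conjLocal L (IsCMField.complexConj L) v)) →* ℂˣ),
      Continuous (fun x => ((χ₁ x : ℂˣ) : ℂ)) → Continuous (fun x => ((χ₂ x : ℂˣ) : ℂ)) →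
      (∀ a : (UnitaryGroup.LocalRing L v)ˣ, (conjLocal L (IsCMField.complexConj L) v) (a : UnitaryGroup.LocalRing L v) = a → χ₁ a = 1) → χ₁ ≠ 1 →
      ∃ N : Subrepresentation (UnitaryGroup.cmPrincipalSeries L 3 v (UnitaryGroup.cmTorusCharPair L v χ₁ χ₂)), N ≠ ⊥ ∧ N ≠ ⊤ :=
  F0P3cStCharTSKeysRedThreeOfEigenfunctional.keysRedThree_of_secondEigenfunctional L v (hSecond_holds L v hns)

end CM

end Summit.HodgeConjecture.HodgeConjecture.Cruxes.H413.F0P3cStCharTSKeys3AnalyticHalf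

end
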